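import Summits.NavierStokesRegularity.NavierStokesRegularity.Theses.TypeICertificateLadder
import Literature.Analysis.FluidPDE.NSBoundedMildOseen
import Literature.Analysis.FluidPDE.NSCriticalClosureBesovKatoClass

/-!
# Line `quiet-point-subcritical-upgrade` for crux `TypeICertificateLadder.TypeIConcentration`
# (item stmt-NavierStokesRegularity-2881, rank 4) — planner skeleton (crux-plan, round 1, 2026-08-16)

Idea card: `Cruxes/TypeIConcentration/Ideas/quiet-point-subcritical-upgrade.md` (ideator 3; triage r1-1/2/3:
pass ×3). Line card: `Cruxes/TypeIConcentration/Lines/quiet-point-subcritical-upgrade.md`.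

THE LINE. Under the pointwise Type-I(C) ENVELOPE `√(T−s)‖u(s,x)‖ ≤ C√ν` on `[t,T) × ℝ³`, a similarity
ball `B(x₀, ρ√(ν(T−t)))` that is `c`-QUIET at time `t` (`√(T−t)‖u(t,·)‖ ≤ c√ν` there) is in fact
SUBCRITICAL on the unit similarity ball for all later times (S3, the self-improving shielded Oseen
bootstrap: `‖u(s,y)‖ ≤ 4c√ν (T−t)^{-3/8}(T−s)^{-1/8}`), and one more energy-capped pass of the Oseen
formula bounds `u` near `(T,x₀)` (S4: QUIET ⇒ REGULAR POINT). Contrapositive at the singular point `x₀`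
given by the tree (`exists_singularPoint_of_classical_of_not_hasSmoothExtensionPast`): `x₀` is `c`-LOUD
within `ρ√(ν(T−t))` at EVERY late time `t`, and a loud point under the envelope carries `L³` mass
`γ ν³` on a ball of radius `r₁√(ν(T−t))` (S5, KNSS gradient bound + mean value) — the crux with
`ρ_crux = ρ + r₁`, `γ = γ(C)`, constants depending on `C` only, WITHOUT item 2884 / Morrey bounds /
ε-regularity / Leray's floor / covering.

STUBS (5; every statement over tree vocabulary only — no local `def`, no notation — so that each lands
verbatim as `Theorems/TypeICertificateLadderTypeIConcentration<Stub>.lean --supports stmt-…-2881`; helper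
files copy the `open` lines below):
* S1 `stub_oseenRepresentation` (M) — Oseen/Duhamel representation of a Clay-class solution restarted at
  any time `t ∈ [0,T)`, pointwise. WHERE `IsLerayHopfOn` + `HasRapidSpatialDecay` ARE SPENT (Disproof §4).
* S2 `stub_oseenKernelTail` (M) — exterior `L¹` tail of the Oseen–Koch–Tataru kernel, uniform in time:
  `∫_{‖x−y‖≥D} ‖K(τ,x−y)[a(y),b(y)]‖ dy ≤ (C_K/D)‖a‖_∞‖b‖_∞`.
* S3 `stub_quietDecayUpgrade` (L, HARDEST, load-bearing) — S1 → S2 → QUIET IS SUBCRITICAL.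
* S4 `stub_quietImpliesRegular` (M) — S1 → S3-conclusion → QUIET ⇒ REGULAR POINT (energy cap spent here).
* S5 `stub_loudPointMass` (M) — S1 → a `c`-loud point under the envelope carries `L³` mass `γν³` nearby.
COMPOSITION `TypeIConcentration_of` (sorry-free): S4(S1, S3(S1,S2)) gives `(c, ρ)`, S5(S1) gives
`(r₁, γ)`; onset `t₁` of the eventual rate; singular point `x₀` (tree, PROVED); at every
`t ∈ ((t₁+T)/2, T)` the point `x₀` is not `(c,ρ)`-quiet (else S4 contradicts
`eLpNorm_top_parabolicCylinder_eq_top_of_small`), so a loud `y ∈ closedBall x₀ (ρ√(ν(T−t)))` exists, S5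
gives the mass on `ball y (r₁√(ν(T−t))) ⊆ ball x₀ ((ρ+r₁)√(ν(T−t)))`, monotonicity of the integral.

DISPROOF USED (`Cruxes/TypeIConcentration/Disproof.lean`, gen 2 v3, read 2026-08-16):
`typeIConcentration_false_without_noExtension` — honoured: `¬HasSmoothExtensionPast` is consumed in the
composition (singular point); `typeIConcentration_false_without_LerayHopf` (ODE flow `u = a_c(t)e₁`,
classical + Schwartz datum + exact rate, NOT finite energy) — honoured twice: the ODE flow violates S1's
conclusion (`e^{θΔ}` fixes constants and `B(const,const) = 0` by oddness of `K` in `z`, so the RHS of S1 is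
`u(t) ≠ u(s)`), and S4 spends the energy inequality (`IsLerayHopfOn.lintegral_enorm_sq_le`) on the far
field — without it the far field is the log-divergent drift `(C²/D)log((T−t)/(T−s))` (card, falsifier 4);
`mass_le_of_rate` / `no_witness_above_rate_ceiling` — respected (`γ ∝ c⁶/C₁(C)³ ≪ |B₁|ρ³C³`);
`Concentrates.mono` — the composition's last step is exactly this monotonicity; `typeIConcentration_iff_withoutPositivity`
— `0<ν`, `0<T` used only as conveniences. No `-- Targets`, no landed `Negative/` lemma exists for this crux.
-/

namespace Summit.NavierStokesRegularity.NavierStokesRegularity.Cruxes.TypeIConcentration.QuietPointSubcriticalUpgrade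

-- Helper (stub) files copy exactly these `open` lines.
open MeasureTheory Set Filter Topology Metric Function
open scoped ENNReal NNReal
open Literature.Analysis.FluidPDE
open Summit.NavierStokesRegularity.NavierStokesRegularity.Theses.TypeICertificateLadder

set_option linter.dupNamespace false
set_option linter.unusedVariables false

/-! ## S1 — the Oseen representation restarted at any time (where finite energy is spent) -/

/-- **S1 (`stub_oseenRepresentation`, size M).** A classical solution of unforced NS on `ℝ³ × [0,T)`
which is Leray–Hopf from its rapidly decaying datum satisfies, for all `0 ≤ t < s < T` and EVERY `x`,
the Oseen integral equation restarted at `t`: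
`u(s,x) = e^{ν(s−t)Δ}u(t)(x) − ∫ₜˢ∫ K(ν(s−σ), x−y)[u(σ,y),u(σ,y)] dy dσ`
(`heatExtension (u t) (ν(s−t))`, `oseenDuhamel ν t u u s`). Why true: `u` is bounded on the closed
strip `[0,s]` (`exists_forall_norm_le_of_tao2011` + `tao2011_hasBoundedSobolevNormsOn_holds`), is a
duality-form mild solution from `u 0` (`isMildNSSolutionOn_of_isLerayHopfOn_holds`), hence solves the
Oseen equation from time `0` a.e. (`ae_eq_heatExtension_sub_oseenDuhamel_of_isMildNSSolutionOn`,
`exists_const_oseenMild_of_bounded_isMildNSSolutionOn`); RESTART at `t > 0` by the proved fact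
`oseenMild_restart_holds` (`oseenMild_restart`, NSBoundedMildOseen.lean:243 / NSBoundedMildOseenRestart.lean:
a.e. identity from `0` + `L^∞` bounds on sub-strips ⇒ a.e. identity from every `0 < t < s < T`), and
upgrade a.e. → everywhere by continuity of both sides (classical slices; dominated convergence for the
Duhamel term, cf. `exists_local_smooth_representative`). This is the step the ODE flow of
Disproof §4 fails (`heatExtension_const`: `e^{θΔ}` fixes constants, `B(const,const) = 0`; finite energy is
load-bearing). Sources: Leray 1934 (3.2); Ożański–Pooley 2018 (6.55); Lemarié-Rieusset 2016 Thm 6.1 /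
Prop 6.5; KNSS 2009 §4 (4.3)–(4.4) (arXiv:0709.3599). -/
theorem stub_oseenRepresentation :
    ∀ (ν T : ℝ), 0 < ν → 0 < T →
    ∀ (u : ℝ → EuclideanSpace ℝ (Fin 3) → EuclideanSpace ℝ (Fin 3))
      (p : ℝ → EuclideanSpace ℝ (Fin 3) → ℝ),
      IsClassicalNSSolutionOn (Set.Ico 0 T) ν 0 u p → IsLerayHopfOn T ν 0 (u 0) u →
      HasRapidSpatialDecay (u 0) →
      ∀ (t s : ℝ), 0 ≤ t → t < s → s < T → ∀ x : EuclideanSpace ℝ (Fin 3),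
        u s x = Literature.Analysis.UnboundedOperators.heatExtension (u t) (ν * (s - t)) x -
          oseenDuhamel ν t u u s x := by
  sorry

/-! ## S2 — exterior `L¹` tail of the Oseen kernel, uniform in time -/

/-- **S2 (`stub_oseenKernelTail`, size M).** There is `C_K > 0` (dimension 3) such that for every
`τ > 0`, `D > 0`, fields `a, b` bounded by `Ma, Mb`, and every `x`:
`∫_{D ≤ ‖x−y‖} ‖K(τ, x−y)[a(y), b(y)]‖ dy ≤ (C_K/D) Ma Mb` — the far field of the Duhamel term is
shielded by DISTANCE uniformly in time. Why true: Koch–Tataru's bound (14) in the tree,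
`exists_norm_oseenKernel_le : ‖K(τ,z)[a,b]‖ ≤ C(τ+‖z‖²)^{-2}‖a‖‖b‖` (d = 3), and
`∫_{‖z‖≥D}(τ+‖z‖²)^{-2}dz ≤ ∫_{‖z‖≥D}‖z‖^{-4}dz = 4π/D` (polar coordinates, or dyadic shells with
`EuclideanSpace.volume_ball_fin_three`: `≤ (64π/3)/D`). Companion facts already PROVED in the tree and
not restated: the slice bound `exists_lintegral_enorm_oseenKernel_slice_le` (`≤ C₀σ^{-1/2}MaMb`) and the
pointwise bound itself. Sources: Koch–Tataru 2001 §3 (14); KNSS 2009 §3 (3.5). -/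
theorem stub_oseenKernelTail :
    ∃ CK : ℝ, 0 < CK ∧ ∀ (τ : ℝ), 0 < τ → ∀ (D : ℝ), 0 < D →
      ∀ (a b : EuclideanSpace ℝ (Fin 3) → EuclideanSpace ℝ (Fin 3)) (Ma Mb : ℝ),
        (∀ y, ‖a y‖ ≤ Ma) → (∀ y, ‖b y‖ ≤ Mb) → ∀ x : EuclideanSpace ℝ (Fin 3),
          ∫⁻ y in {y | D ≤ ‖x - y‖}, ‖oseenKernel τ (x - y) (a y) (b y)‖ₑ ≤
            ENNReal.ofReal (CK / D * Ma * Mb) := by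
  sorry

/-! ## S3 — QUIET IS SUBCRITICAL: the self-improving shielded bootstrap (hardest stub) -/

/-- **S3 (`stub_quietDecayUpgrade`, size L, LOAD-BEARING).** Given S1 and S2: for every `C > 0` there
are a threshold `c = c(C) > 0` (the proof gives the universal `c = 1/(64 C₀)`, `C₀` of
`exists_lintegral_enorm_oseenKernel_slice_le`) and a radius `ρ = ρ(C) > 1` (`ρ = 1 + λ + m`,
`λ = λ(C,c)` from `C²C_KΨ_{1/16}(λ) ≤ c`, `m = m(C,c)` from the Gaussian tail) such that: if the
envelope `√(T−s)‖u(s,x)‖ ≤ C√ν` holds on `[t,T) × ℝ³` and `x₀` is `(c,ρ)`-quiet at time `t`, then on the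
FIXED ball `closedBall x₀ √(ν(T−t))` and for all `s ∈ [t,T)`,
`‖u(s,y)‖ ≤ 4c√ν (T−t)^{-3/8}(T−s)^{-1/8}` — decay in critical units like `v^{3/8}`,
`v = (T−s)/(T−t)`. Why true (card + triage r1-1/2/3 re-derivations): first-touching-time argument for
`G(σ) = v_σ^{-3/8}√(T−σ) max_{𝒞(σ)}‖u(σ,·)‖/√ν` on the POLYNOMIALLY receding control region
`𝒞(σ) = closedBall x₀ ((1 + λ v_σ^{1/16})√(ν(T−t)))`, using S1 from time `t` at the touching point:
DATA `≤ 1.5c` (quiet part + heat-kernel tail over the margin `m√(ν(T−t))`, `heatKernel_le_tail`),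
INSIDE `≤ 64c²C₀ v^{1/8} ≤ c` (slice bound; `∫ₜˢ(s−σ)^{-1/2}(T−σ)^{-1/4}dσ ≤ 4(s−t)^{1/4}`), OUTSIDE
`≤ C²C_K v^{1/8}I_{1/16}(v) ≤ C²C_KΨ_{1/16}(λ) ≤ c` (S2 with `D = λ(w^{1/16}−v^{1/16})√(ν(T−t))`;
`Ψ_α(λ) = sup_v v^{1/8}∫_v^1 min(π²(w−v)^{-1/2},(4π/λ)(w^α−v^α)^{-1})dw/w = O(log λ/(α²λ)) → 0` because
`α = 1/16 < 1/8`; numerics kit j005575 / j006964 / j007028: `Ψ = 25.3, 2.25, 0.193` at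
`λ = 64, 1024, 16384`), total `3.5c < 4c`. Exponent window `¼ < β < ½ − α` with `β = 3/8`. Magnitude-only:
holds verbatim for cheap-NS (no regularity is claimed here). Sources: arXiv:2003.06717 Lemma 4 / Cor 12
(the `L^{3,∞}` analogue), arXiv:1812.09115 Thm 2, arXiv:0709.3599 §4, Giga–Inui–Matsui 1999. -/
theorem stub_quietDecayUpgrade :
    (∀ (ν T : ℝ), 0 < ν → 0 < T →
      ∀ (u : ℝ → EuclideanSpace ℝ (Fin 3) → EuclideanSpace ℝ (Fin 3))
        (p : ℝ → EuclideanSpace ℝ (Fin 3) → ℝ),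
        IsClassicalNSSolutionOn (Set.Ico 0 T) ν 0 u p → IsLerayHopfOn T ν 0 (u 0) u →
        HasRapidSpatialDecay (u 0) →
        ∀ (t s : ℝ), 0 ≤ t → t < s → s < T → ∀ x : EuclideanSpace ℝ (Fin 3),
          u s x = Literature.Analysis.UnboundedOperators.heatExtension (u t) (ν * (s - t)) x -
            oseenDuhamel ν t u u s x) →
    (∃ CK : ℝ, 0 < CK ∧ ∀ (τ : ℝ), 0 < τ → ∀ (D : ℝ), 0 < D →
      ∀ (a b : EuclideanSpace ℝ (Fin 3) → EuclideanSpace ℝ (Fin 3)) (Ma Mb : ℝ),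
        (∀ y, ‖a y‖ ≤ Ma) → (∀ y, ‖b y‖ ≤ Mb) → ∀ x : EuclideanSpace ℝ (Fin 3),
          ∫⁻ y in {y | D ≤ ‖x - y‖}, ‖oseenKernel τ (x - y) (a y) (b y)‖ₑ ≤
            ENNReal.ofReal (CK / D * Ma * Mb)) →
    ∀ C : ℝ, 0 < C → ∃ c : ℝ, 0 < c ∧ ∃ ρ : ℝ, 1 < ρ ∧
      ∀ (ν T t : ℝ), 0 < ν → 0 ≤ t → t < T →
      ∀ (u : ℝ → EuclideanSpace ℝ (Fin 3) → EuclideanSpace ℝ (Fin 3))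
        (p : ℝ → EuclideanSpace ℝ (Fin 3) → ℝ),
        IsClassicalNSSolutionOn (Set.Ico 0 T) ν 0 u p → IsLerayHopfOn T ν 0 (u 0) u →
        HasRapidSpatialDecay (u 0) →
        (∀ s ∈ Set.Ico t T, ∀ x : EuclideanSpace ℝ (Fin 3),
            Real.sqrt (T - s) * ‖u s x‖ ≤ C * Real.sqrt ν) →
        ∀ x₀ : EuclideanSpace ℝ (Fin 3),
          (∀ y ∈ Metric.closedBall x₀ (ρ * Real.sqrt (ν * (T - t))),
              Real.sqrt (T - t) * ‖u t y‖ ≤ c * Real.sqrt ν) →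
          ∀ s ∈ Set.Ico t T, ∀ y ∈ Metric.closedBall x₀ (Real.sqrt (ν * (T - t))),
            ‖u s y‖ ≤ 4 * c * Real.sqrt ν * (T - t) ^ (-(3 / 8 : ℝ)) * (T - s) ^ (-(1 / 8 : ℝ)) := by
  sorry

/-! ## S4 — QUIET ⇒ REGULAR POINT: one energy-capped pass of the Oseen formula -/

/-- **S4 (`stub_quietImpliesRegular`, size M).** Given S1 and the conclusion of S3: for every `C > 0`
there are `c > 0`, `ρ > 0` (those of S3) such that under the envelope on `[t,T)` a point `x₀` that is
`(c,ρ)`-quiet at time `t` is a REGULAR point of `(T,x₀)` in the tree's sense: `u` is essentially bounded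
on some backward parabolic cylinder `Q_r(T,x₀) = (T−r²,T) × B_r(x₀)` (`parabolicCylinder`). Why true:
for `y ∈ ball x₀ (√(ν(T−t))/2)`, `s ∈ (t,T)`, write `u(s,y)` by S1 from time `t`: DATA
`≤ C√ν/√(T−t)` (heat semigroup is an `L^∞` contraction); INSIDE the unit similarity ball S3's
SUBCRITICAL bound makes the source time-integrable: `≤ 16c²C₀√ν(T−t)^{-3/4}∫ₜˢ(s−σ)^{-1/2}(T−σ)^{-1/4}dσ
≤ 64c²C₀√ν/√(T−t)`; OUTSIDE (`‖z−y‖ ≥ √(ν(T−t))/2 =: D`) the kernel SUP bound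
`‖K(θ,z)‖ ≤ C(θ+‖z‖²)^{-2} ≤ C D^{-4}` (`exists_norm_oseenKernel_le`) against the ENERGY
`∫‖u(σ)‖² ≤ 2E₀` (`IsLerayHopfOn.lintegral_enorm_sq_le`) gives `≤ 32 C E₀/(ν²(T−t))`. So
`‖u‖ ≤ K(C,c,ν,T−t,E₀)` on `ball x₀ (√(ν(T−t))/2) × (t,T)` ⊇ `Q_r(T,x₀)` for
`r = min(√(ν(T−t))/2, √(T−t))`; continuity gives the `eLpNorm` bound. The energy cap is NECESSARY here
(cheap-NS barrier: without it the far field is the unbounded log-drift) — this is where finite energy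
is spent a second time. Sources: arXiv:2003.06717 Cor 12 (the `L^{3,∞}` analogue "quiet ⇒ bounded");
KNSS 2009 §4; CKN 1982 §2 (cylinders). -/
theorem stub_quietImpliesRegular :
    (∀ (ν T : ℝ), 0 < ν → 0 < T →
      ∀ (u : ℝ → EuclideanSpace ℝ (Fin 3) → EuclideanSpace ℝ (Fin 3))
        (p : ℝ → EuclideanSpace ℝ (Fin 3) → ℝ),
        IsClassicalNSSolutionOn (Set.Ico 0 T) ν 0 u p → IsLerayHopfOn T ν 0 (u 0) u →
        HasRapidSpatialDecay (u 0) →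
        ∀ (t s : ℝ), 0 ≤ t → t < s → s < T → ∀ x : EuclideanSpace ℝ (Fin 3),
          u s x = Literature.Analysis.UnboundedOperators.heatExtension (u t) (ν * (s - t)) x -
            oseenDuhamel ν t u u s x) →
    (∀ C : ℝ, 0 < C → ∃ c : ℝ, 0 < c ∧ ∃ ρ : ℝ, 1 < ρ ∧
      ∀ (ν T t : ℝ), 0 < ν → 0 ≤ t → t < T →
      ∀ (u : ℝ → EuclideanSpace ℝ (Fin 3) → EuclideanSpace ℝ (Fin 3))
        (p : ℝ → EuclideanSpace ℝ (Fin 3) → ℝ),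
        IsClassicalNSSolutionOn (Set.Ico 0 T) ν 0 u p → IsLerayHopfOn T ν 0 (u 0) u →
        HasRapidSpatialDecay (u 0) →
        (∀ s ∈ Set.Ico t T, ∀ x : EuclideanSpace ℝ (Fin 3),
            Real.sqrt (T - s) * ‖u s x‖ ≤ C * Real.sqrt ν) →
        ∀ x₀ : EuclideanSpace ℝ (Fin 3),
          (∀ y ∈ Metric.closedBall x₀ (ρ * Real.sqrt (ν * (T - t))),
              Real.sqrt (T - t) * ‖u t y‖ ≤ c * Real.sqrt ν) →
          ∀ s ∈ Set.Ico t T, ∀ y ∈ Metric.closedBall x₀ (Real.sqrt (ν * (T - t))),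
            ‖u s y‖ ≤ 4 * c * Real.sqrt ν * (T - t) ^ (-(3 / 8 : ℝ)) * (T - s) ^ (-(1 / 8 : ℝ))) →
    ∀ C : ℝ, 0 < C → ∃ c : ℝ, 0 < c ∧ ∃ ρ : ℝ, 0 < ρ ∧
      ∀ (ν T t : ℝ), 0 < ν → 0 ≤ t → t < T →
      ∀ (u : ℝ → EuclideanSpace ℝ (Fin 3) → EuclideanSpace ℝ (Fin 3))
        (p : ℝ → EuclideanSpace ℝ (Fin 3) → ℝ),
        IsClassicalNSSolutionOn (Set.Ico 0 T) ν 0 u p → IsLerayHopfOn T ν 0 (u 0) u →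
        HasRapidSpatialDecay (u 0) →
        (∀ s ∈ Set.Ico t T, ∀ x : EuclideanSpace ℝ (Fin 3),
            Real.sqrt (T - s) * ‖u s x‖ ≤ C * Real.sqrt ν) →
        ∀ x₀ : EuclideanSpace ℝ (Fin 3),
          (∀ y ∈ Metric.closedBall x₀ (ρ * Real.sqrt (ν * (T - t))),
              Real.sqrt (T - t) * ‖u t y‖ ≤ c * Real.sqrt ν) →
          ∃ r : ℝ, 0 < r ∧
            eLpNorm (Function.uncurry u) ∞
              (volume.restrict (parabolicCylinder r (T, x₀))) < ∞ := by
  sorry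

/-! ## S5 — a LOUD point under the envelope carries `L³` mass at the similarity scale -/

/-- **S5 (`stub_loudPointMass`, size M).** Given S1: for every `C > 0` and `c > 0` there are
`r₁ = r₁(C,c) > 0` and `γ = γ(C,c) > 0` such that under the envelope on `[t₁,T)`, at every time
`t ∈ ((t₁+T)/2, T)` and every point `y` with `√(T−t)‖u(t,y)‖ ≥ c√ν` (a `c`-LOUD point),
`γ ν³ ≤ ∫_{ball y (r₁√(ν(T−t)))} ‖u(t)‖³`. Why true: (i) GRADIENT UNDER THE ENVELOPE — on the window
`[t − h, t]`, `h = min(T−t, εν/N²)` with `N = C√ν/√(T−t)` (inside `[t₁,T)` because `t > (t₁+T)/2`), `u` is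
the bounded Oseen-mild solution from `u(t−h)` (S1), so KNSS smoothing (`knss2009_local_smoothing_holds`,
`k=1,l=0`, + `oseenMild_bounded_unique`; or `IsKNSSDriftMild.exists_gradient_bound` after the viscosity
normalisation `timeRescale`) gives `(T−t)‖∇u(t,x)‖ ≤ C₁(C) = O(C + C²)`; (ii) MEAN VALUE on
`ball y (r₁√(ν(T−t)))`, `r₁ = c/(2C₁)`: `‖u(t,x)‖ ≥ c√ν/(2√(T−t))`, hence
`∫ ≥ |B₁| r₁³ (c/2)³ ν³ = (π/48)(c⁶/C₁³)ν³ =: γν³` (`EuclideanSpace.volume_ball_fin_three`,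
`Convex.norm_image_sub_le_of_norm_fderiv_le`). Triage r1-3's sharpening (the `C`-only gradient bound
exists only a definite time after the onset) is why `t > (t₁+T)/2`. Sources: arXiv:0709.3599 Prop 4.1
(4.6); SereginSverak2009 Lemma 3.5. -/
theorem stub_loudPointMass :
    (∀ (ν T : ℝ), 0 < ν → 0 < T →
      ∀ (u : ℝ → EuclideanSpace ℝ (Fin 3) → EuclideanSpace ℝ (Fin 3))
        (p : ℝ → EuclideanSpace ℝ (Fin 3) → ℝ),
        IsClassicalNSSolutionOn (Set.Ico 0 T) ν 0 u p → IsLerayHopfOn T ν 0 (u 0) u →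
        HasRapidSpatialDecay (u 0) →
        ∀ (t s : ℝ), 0 ≤ t → t < s → s < T → ∀ x : EuclideanSpace ℝ (Fin 3),
          u s x = Literature.Analysis.UnboundedOperators.heatExtension (u t) (ν * (s - t)) x -
            oseenDuhamel ν t u u s x) →
    ∀ C : ℝ, 0 < C → ∀ c : ℝ, 0 < c → ∃ r₁ : ℝ, 0 < r₁ ∧ ∃ γ : ℝ, 0 < γ ∧
      ∀ (ν T t₁ : ℝ), 0 < ν → 0 ≤ t₁ → t₁ < T →
      ∀ (u : ℝ → EuclideanSpace ℝ (Fin 3) → EuclideanSpace ℝ (Fin 3))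
        (p : ℝ → EuclideanSpace ℝ (Fin 3) → ℝ),
        IsClassicalNSSolutionOn (Set.Ico 0 T) ν 0 u p → IsLerayHopfOn T ν 0 (u 0) u →
        HasRapidSpatialDecay (u 0) →
        (∀ s ∈ Set.Ico t₁ T, ∀ x : EuclideanSpace ℝ (Fin 3),
            Real.sqrt (T - s) * ‖u s x‖ ≤ C * Real.sqrt ν) →
        ∀ t ∈ Set.Ioo ((t₁ + T) / 2) T, ∀ y : EuclideanSpace ℝ (Fin 3),
          c * Real.sqrt ν ≤ Real.sqrt (T - t) * ‖u t y‖ →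
          γ * ν ^ 3 ≤ ∫ x in Metric.ball y (r₁ * Real.sqrt (ν * (T - t))), ‖u t x‖ ^ 3 := by
  sorry

/-! ## The composition: the crux from S1–S5 (kernel-checked, no `sorry` outside the stubs) -/

/-- **`TypeIConcentration` from the five stubs.** For `C > 0` take `(c, ρ)` from S4 (fed S1 and
S3(S1, S2)) and `(r₁, γ)` from S5 (fed S1) at `(C, c)`; the crux holds with radius `ρ + r₁` and
threshold `γ`. Given a Type-I(C) blow-up: the eventual rate starts at some `t₀ < T`; put
`t₁ = max 0 ((t₀+T)/2)`, so the envelope holds on `[t₁,T)`; `¬HasSmoothExtensionPast` gives a singular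
point `x₀` (`exists_singularPoint_of_classical_of_not_hasSmoothExtensionPast`, PROVED in the tree). For
every `t ∈ ((t₁+T)/2, T)` (an `𝓝[<] T`-neighbourhood): were `x₀` `(c,ρ)`-quiet at `t`, S4 would bound
`u` on a backward cylinder at `(T,x₀)`, contradicting `eLpNorm_top_parabolicCylinder_eq_top_of_small`;
so some `y ∈ closedBall x₀ (ρ√(ν(T−t)))` is `c`-loud, S5 puts mass `γν³` on
`ball y (r₁√(ν(T−t))) ⊆ ball x₀ ((ρ+r₁)√(ν(T−t)))`, and the integral of the continuous non-negative
`‖u(t)‖³` is monotone in the ball (`setIntegral_mono_set`). No covering, no Leray floor, no item 2884. -/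
theorem TypeIConcentration_of : TypeIConcentration := by
  intro C hC
  obtain ⟨c, hc, ρ, hρ, hQR⟩ := stub_quietImpliesRegular stub_oseenRepresentation
    (stub_quietDecayUpgrade stub_oseenRepresentation stub_oseenKernelTail) C hC
  obtain ⟨r₁, hr₁, γ, hγ, hLM⟩ := stub_loudPointMass stub_oseenRepresentation C hC c hc
  refine ⟨ρ + r₁, by positivity, γ, hγ, ?_⟩
  intro ν T hν hT u p hcl hLH hdec hrate hext
  -- onset of the eventual rate: the envelope holds on `[t₁, T)`, `0 ≤ t₁ < T`
  obtain ⟨t₀, ht₀T', ht₀⟩ := mem_nhdsLT_iff_exists_Ioo_subset.1 hrate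
  have ht₀T : t₀ < T := Set.mem_Iio.1 ht₀T'
  set t₁ : ℝ := max 0 ((t₀ + T) / 2) with ht₁def
  have ht₁0 : 0 ≤ t₁ := le_max_left _ _
  have ht₁T : t₁ < T := max_lt hT (by linarith)
  have ht₀t₁ : t₀ < t₁ := lt_of_lt_of_le (by linarith) (le_max_right _ _)
  have henv : ∀ s ∈ Set.Ico t₁ T, ∀ x : EuclideanSpace ℝ (Fin 3),
      Real.sqrt (T - s) * ‖u s x‖ ≤ C * Real.sqrt ν :=
    fun s hs x => ht₀ ⟨ht₀t₁.trans_le hs.1, hs.2⟩ x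
  -- the singular point (this is where `¬ HasSmoothExtensionPast` is consumed)
  obtain ⟨x₀, hx₀⟩ :=
    exists_singularPoint_of_classical_of_not_hasSmoothExtensionPast hν hT hcl hLH hdec hext
  refine ⟨x₀, ?_⟩
  have hmid : (t₁ + T) / 2 < T := by linarith
  filter_upwards [Ioo_mem_nhdsLT hmid] with t ht
  have ht₁t : t₁ ≤ t := by linarith [ht.1]
  have ht0 : 0 ≤ t := ht₁0.trans ht₁t
  have htT : t < T := ht.2
  have henvt : ∀ s ∈ Set.Ico t T, ∀ x : EuclideanSpace ℝ (Fin 3),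
      Real.sqrt (T - s) * ‖u s x‖ ≤ C * Real.sqrt ν :=
    fun s hs x => henv s ⟨ht₁t.trans hs.1, hs.2⟩ x
  -- `x₀` is NOT `(c, ρ)`-quiet at time `t`: otherwise S4 makes `(T, x₀)` a regular point
  have hloud : ∃ y ∈ Metric.closedBall x₀ (ρ * Real.sqrt (ν * (T - t))),
      c * Real.sqrt ν < Real.sqrt (T - t) * ‖u t y‖ := by
    by_contra hq
    push Not at hq
    obtain ⟨r, hr, hfin⟩ := hQR ν T t hν ht0 htT u p hcl hLH hdec henvt x₀ hq
    exact hfin.ne (eLpNorm_top_parabolicCylinder_eq_top_of_small hT hx₀ hr)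
  obtain ⟨y, hy, hyl⟩ := hloud
  -- a loud point carries mass (S5), inside the bigger ball around `x₀`
  have hmass := hLM ν T t₁ hν ht₁0 ht₁T u p hcl hLH hdec henv t ht y hyl.le
  refine hmass.trans ?_
  have hsub : Metric.ball y (r₁ * Real.sqrt (ν * (T - t))) ⊆
      Metric.ball x₀ ((ρ + r₁) * Real.sqrt (ν * (T - t))) := by
    intro x hx
    rw [Metric.mem_ball] at hx ⊢
    rw [Metric.mem_closedBall] at hy
    calc dist x x₀ ≤ dist x y + dist y x₀ := dist_triangle _ _ _
      _ < r₁ * Real.sqrt (ν * (T - t)) + ρ * Real.sqrt (ν * (T - t)) :=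
          add_lt_add_of_lt_of_le hx hy
      _ = (ρ + r₁) * Real.sqrt (ν * (T - t)) := by ring
  have hcont : Continuous (u t) := (hcl.contDiff_velocity ⟨ht0, htT⟩).continuous
  have hint : IntegrableOn (fun x => ‖u t x‖ ^ 3)
      (Metric.closedBall x₀ ((ρ + r₁) * Real.sqrt (ν * (T - t)))) volume :=
    ((hcont.norm.pow 3).continuousOn).integrableOn_compact (isCompact_closedBall _ _)
  exact setIntegral_mono_set (hint.mono_set Metric.ball_subset_closedBall)
    (ae_of_all _ fun x => by positivity) hsub.eventuallyLE

end Summit.NavierStokesRegularity.NavierStokesRegularity.Cruxes.TypeIConcentration.QuietPointSubcriticalUpgrade
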